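import Literature.MathematicalPhysics.QuantumFieldTheory.Balaban1983to89.T4EMLFibreAC

/-!
# Route `UnitScaleTilt` — crux K1bR-pr `FluctuationComparisonRegPr` (stmt-QuantumFields-19201), stub `stub_oneStepSmallLift`
# (W7 line), step 1a: THE DIFFERENTIAL OF THE EXP-MEAN-LOG FIBRE MAP AT ITS DEGENERATE POINT AND ITS JOINT CONTINUITY
# (support file `--supports stmt-QuantumFields-19201`; quaternion calculus, no Bałaban estimate is used)

Cell `ym3-torus` (rung R3), seat `ym3-torus-p2` gen 8.  In the private central-bond coordinate of `BlockAveragingHaarAC` the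
(0.4) block average at a coarse bond is the ONE-VARIABLE fibre map `W ↦ exp(Σ_k |I|⁻¹ log(h_k W*))·W` of the off-central open
holonomies `h_k` (`BlockAveragingEMLHaarAC.coe_fibreCore_eq`); in the quaternion model of `T4EMLFibreAC` it is
`kf a c u = exp(Σ_i c_i • qlog(a_i ū))·u` with differential `kD a c u`.  «EXACTNESS IS FREE» for the one-step small lift
(sibling files `…FibreLocalInverse`, `…MiddleBondRepair`) needs a quantitative local inverse of this map near its DEGENERATE
POINT `a_i = u = 1` (all loop variables trivial).  This file supplies the two calculus inputs:

* §1 the MODEL DIFFERENTIAL `D₀ v = v + s • v̄` (`s = Σ c_i`): an explicit continuous linear equivalence with inverse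
  `(1 − s²)⁻¹(id − s • star)` and `‖D₀⁻¹‖ ≤ (1 − s)⁻¹` for `0 ≤ s < 1` (`dZeroEquiv`, `norm_dZeroInv_le`);
* §2 `kD 1 c 1 = D₀` (`qlog 1 = 0`, `D exp(0) = id`, `D qlog(1) = id`; `kD_one_one`);
* §3 JOINT CONTINUITY of `(a, u) ↦ kD a c u` in the operator norm on the open guard region `{‖a_i ū − 1‖ < 1}`
  (analyticity of `exp`, smoothness of `qlog`; `continuousOn_kD`, `continuousAt_kD_one`).

Every declaration is elementary calculus on `ℍ` ([folklore]); nothing of Bałaban's is asserted.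
-/

noncomputable section

open NormedSpace Set Metric Function Filter Topology
open scoped RealInnerProductSpace Quaternion NNReal

namespace Summit.QuantumFields.YangMills.Theorems.FibreLocalInverse

open Literature.MathematicalPhysics.QuantumFieldTheory.Balaban1983to89.T4EMLFibreAC
open Literature.MathematicalPhysics.QuantumFieldTheory.Balaban1983to89.T4QuatExpLog

/-! ## §1 The model differential `D₀ v = v + s • v̄` -/

section Model

/-- `star` as a continuous real-linear map of `ℍ` (`= mulStarCLM 1`). -/
def starCLM : ℍ →L[ℝ] ℍ := mulStarCLM 1

/-- Evaluation of `starCLM`. -/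
@[simp] theorem starCLM_apply (v : ℍ) : starCLM v = star v := by
  simp [starCLM]

/-- `star ∘ star = id` on `ℍ`, as continuous linear maps. -/
theorem starCLM_comp_starCLM : starCLM.comp starCLM = ContinuousLinearMap.id ℝ ℍ :=
  ContinuousLinearMap.ext fun v => by simp

/-- `star (s • v) = s • star v` for a real scalar (no `StarModule ℝ ℍ` instance is registered). -/
theorem star_smul_real (s : ℝ) (v : ℍ) : star (s • v) = s • star v := Quaternion.star_smul s v

/-- `‖starCLM v‖ = ‖v‖`. -/
theorem norm_starCLM_apply (v : ℍ) : ‖starCLM v‖ = ‖v‖ := by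
  rw [starCLM_apply, norm_star]

/-- `‖starCLM‖ ≤ 1`. -/
theorem norm_starCLM_le : ‖starCLM‖ ≤ 1 :=
  ContinuousLinearMap.opNorm_le_bound _ zero_le_one fun v => by rw [norm_starCLM_apply, one_mul]

/-- THE MODEL DIFFERENTIAL at the degenerate point: `D₀ v = v + s • v̄`. -/
def dZero (s : ℝ) : ℍ →L[ℝ] ℍ := ContinuousLinearMap.id ℝ ℍ + s • starCLM

/-- Evaluation of `dZero`. -/
@[simp] theorem dZero_apply (s : ℝ) (v : ℍ) : dZero s v = v + s • star v := by
  simp [dZero]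

/-- The explicit inverse `(1 − s²)⁻¹ • (id − s • star)`. -/
def dZeroInv (s : ℝ) : ℍ →L[ℝ] ℍ := (1 - s ^ 2)⁻¹ • (ContinuousLinearMap.id ℝ ℍ - s • starCLM)

/-- Evaluation of `dZeroInv`. -/
@[simp] theorem dZeroInv_apply (s : ℝ) (v : ℍ) : dZeroInv s v = (1 - s ^ 2)⁻¹ • (v - s • star v) := by
  simp [dZeroInv]

/-- `dZeroInv s` is a left inverse of `dZero s` (`s² ≠ 1`). -/
theorem dZeroInv_dZero {s : ℝ} (hs : s ^ 2 ≠ 1) (v : ℍ) : dZeroInv s (dZero s v) = v := by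
  have h1 : (1 : ℝ) - s ^ 2 ≠ 0 := sub_ne_zero.mpr (Ne.symm hs)
  rw [dZero_apply, dZeroInv_apply, star_add, star_smul_real, star_star]
  ext <;> simp <;> field_simp <;> ring

/-- `dZeroInv s` is a right inverse of `dZero s` (`s² ≠ 1`). -/
theorem dZero_dZeroInv {s : ℝ} (hs : s ^ 2 ≠ 1) (v : ℍ) : dZero s (dZeroInv s v) = v := by
  have h1 : (1 : ℝ) - s ^ 2 ≠ 0 := sub_ne_zero.mpr (Ne.symm hs)
  rw [dZeroInv_apply, dZero_apply, star_smul_real, star_sub, star_smul_real, star_star]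
  ext <;> simp <;> field_simp <;> ring

/-- `D₀` as a continuous linear equivalence (`s² ≠ 1`). -/
def dZeroEquiv {s : ℝ} (hs : s ^ 2 ≠ 1) : ℍ ≃L[ℝ] ℍ :=
  ContinuousLinearEquiv.equivOfInverse (dZero s) (dZeroInv s) (dZeroInv_dZero hs) (dZero_dZeroInv hs)

/-- The equivalence is `dZero s` as a map. -/
@[simp] theorem coe_dZeroEquiv {s : ℝ} (hs : s ^ 2 ≠ 1) : (dZeroEquiv hs : ℍ →L[ℝ] ℍ) = dZero s := rfl

/-- Its inverse is `dZeroInv s`. -/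
@[simp] theorem coe_dZeroEquiv_symm {s : ℝ} (hs : s ^ 2 ≠ 1) : ((dZeroEquiv hs).symm : ℍ →L[ℝ] ℍ) = dZeroInv s := rfl

/-- `‖D₀⁻¹‖ ≤ (1 − s)⁻¹` for `0 ≤ s < 1`. -/
theorem norm_dZeroInv_le {s : ℝ} (h0 : 0 ≤ s) (h1 : s < 1) : ‖dZeroInv s‖ ≤ (1 - s)⁻¹ := by
  have hpos : 0 < 1 - s := by linarith
  have hpos2 : 0 < 1 - s ^ 2 := by nlinarith
  refine ContinuousLinearMap.opNorm_le_bound _ (inv_nonneg.mpr hpos.le) fun v => ?_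
  rw [dZeroInv_apply, norm_smul, Real.norm_eq_abs, abs_of_pos (inv_pos.mpr hpos2)]
  have hv : ‖v - s • star v‖ ≤ (1 + s) * ‖v‖ := by
    calc ‖v - s • star v‖ ≤ ‖v‖ + ‖s • star v‖ := norm_sub_le _ _
      _ = (1 + s) * ‖v‖ := by rw [norm_smul, norm_star, Real.norm_eq_abs, abs_of_nonneg h0]; ring
  calc (1 - s ^ 2)⁻¹ * ‖v - s • star v‖ ≤ (1 - s ^ 2)⁻¹ * ((1 + s) * ‖v‖) :=
        mul_le_mul_of_nonneg_left hv (inv_nonneg.mpr hpos2.le)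
    _ = (1 - s)⁻¹ * ‖v‖ := by
        have : (1 : ℝ) - s ^ 2 = (1 - s) * (1 + s) := by ring
        rw [this, mul_inv, mul_assoc, ← mul_assoc (1 + s)⁻¹, inv_mul_cancel₀ (by linarith), one_mul]

end Model

/-! ## §2 The differential of the fibre map at the degenerate point is `D₀` -/

section Degenerate

variable {ι : Type*} [Fintype ι]

/-- `D exp(0) = id` on `ℍ`. -/
theorem fderiv_exp_zero : fderiv ℝ (exp : ℍ → ℍ) 0 = ContinuousLinearMap.id ℝ ℍ := by
  have h : HasFDerivAt (exp : ℍ → ℍ) (1 : ℍ →L[ℝ] ℍ) (0 : ℍ) := hasFDerivAt_exp_zero (𝕂 := ℝ)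
  rw [h.fderiv]; rfl

/-- `D qlog(1) = id` on `ℍ`. -/
theorem fderiv_qlog_one : fderiv ℝ qlog (1 : ℍ) = ContinuousLinearMap.id ℝ ℍ := by
  have h := fderiv_qlog_comp_fderiv_exp (u := (1 : ℍ)) (by simp)
  rwa [qlog_one, fderiv_exp_zero, ContinuousLinearMap.comp_id] at h

/-- The exponent vanishes at the degenerate point: `Yf 1 c 1 = 0`. -/
theorem Yf_one_one (c : ι → ℝ) : Yf (fun _ : ι => (1 : ℍ)) c 1 = 0 := by
  simp [Yf]

/-- The fibre map fixes the degenerate point: `kf 1 c 1 = 1`. -/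
theorem kf_one_one (c : ι → ℝ) : kf (fun _ : ι => (1 : ℍ)) c 1 = 1 := by
  rw [kf, Yf_one_one, exp_zero, one_mul]

/-- `YD 1 c 1 v = s • v̄`. -/
theorem YD_one_one_apply (c : ι → ℝ) (v : ℍ) : YD (fun _ : ι => (1 : ℍ)) c 1 v = (∑ i, c i) • star v := by
  rw [YD_apply, Finset.sum_smul]
  refine Finset.sum_congr rfl fun i _ => ?_
  rw [star_one, mul_one, fderiv_qlog_one, one_mul, ContinuousLinearMap.id_apply]

/-- **THE DIFFERENTIAL AT THE DEGENERATE POINT**: `kD 1 c 1 = D₀` with `s = Σ c_i`. -/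
theorem kD_one_one (c : ι → ℝ) : kD (fun _ : ι => (1 : ℍ)) c 1 = dZero (∑ i, c i) :=
  ContinuousLinearMap.ext fun v => by
    rw [kD_apply, Yf_one_one, exp_zero, one_mul, fderiv_exp_zero, YD_one_one_apply, dZero_apply,
      ContinuousLinearMap.id_apply, mul_one]

end Degenerate

/-! ## §3 Joint continuity of the differential `(a, u) ↦ kD a c u` on the guard region -/

section Continuity

variable {ι : Type*} [Fintype ι]

/-- The JOINT GUARD REGION `{(a, u) | ∀ i, ‖a_i ū − 1‖ < 1}` (the domain of the series logarithms). -/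
def guardSet (ι : Type*) : Set ((ι → ℍ) × ℍ) := {p | ∀ i, ‖p.1 i * star p.2 - 1‖ < 1}

omit [Fintype ι] in
/-- Membership in the guard region. -/
theorem mem_guardSet {p : (ι → ℍ) × ℍ} : p ∈ guardSet ι ↔ ∀ i, ‖p.1 i * star p.2 - 1‖ < 1 := Iff.rfl

/-- The guard region is open. -/
theorem isOpen_guardSet : IsOpen (guardSet ι) := by
  have : guardSet ι = ⋂ i, {p : (ι → ℍ) × ℍ | ‖p.1 i * star p.2 - 1‖ < 1} := by
    ext p; simp [guardSet]
  rw [this]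
  refine isOpen_iInter_of_finite fun i => isOpen_lt ?_ continuous_const
  exact ((((continuous_apply i).comp continuous_fst).mul (continuous_star.comp continuous_snd)).sub
    continuous_const).norm

omit [Fintype ι] in
/-- The degenerate point `(1, 1)` lies in the guard region. -/
theorem one_mem_guardSet : ((fun _ : ι => (1 : ℍ)), (1 : ℍ)) ∈ guardSet ι := by
  intro i; simp

/-- `mulStarCLM a = (mul a) ∘ star`. -/
theorem mulStarCLM_eq (a : ℍ) : mulStarCLM a = (ContinuousLinearMap.mul ℝ ℍ a).comp starCLM :=
  ContinuousLinearMap.ext fun v => by simp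

/-- The differential of the exponent as a sum of compositions of continuous linear maps. -/
theorem YD_eq (a : ι → ℍ) (c : ι → ℝ) (u : ℍ) :
    YD a c u = ∑ i, c i • (fderiv ℝ qlog (a i * star u)).comp ((ContinuousLinearMap.mul ℝ ℍ (a i)).comp starCLM) := by
  unfold YD
  refine Finset.sum_congr rfl fun i _ => ?_
  rw [mulStarCLM_eq]

/-- The differential of the fibre map as a continuous-linear-map expression (no scalar actions of `ℍ`). -/
theorem kD_eq (a : ι → ℍ) (c : ι → ℝ) (u : ℍ) :
    kD a c u = ContinuousLinearMap.mul ℝ ℍ (exp (Yf a c u)) +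
      ((ContinuousLinearMap.mul ℝ ℍ).flip u).comp ((fderiv ℝ exp (Yf a c u)).comp (YD a c u)) :=
  ContinuousLinearMap.ext fun v => by rw [kD_apply]; simp

/-- `qlog` is continuous on `‖z − 1‖ < 1`. -/
theorem continuousOn_qlog : ContinuousOn qlog {z : ℍ | ‖z - 1‖ < 1} :=
  fun _ hz => (contDiffAt_qlog hz (n := 1)).continuousAt.continuousWithinAt

/-- `D qlog` is continuous on `‖z − 1‖ < 1`. -/
theorem continuousOn_fderiv_qlog : ContinuousOn (fderiv ℝ qlog) {z : ℍ | ‖z - 1‖ < 1} :=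
  fun _ hz => ((contDiffAt_qlog hz (n := 2)).continuousAt_fderiv (by norm_num)).continuousWithinAt

/-- `exp : ℍ → ℍ` is smooth. -/
theorem contDiff_exp_quat {n : WithTop ℕ∞} : ContDiff ℝ n (exp : ℍ → ℍ) :=
  contDiff_iff_contDiffAt.2 fun x => (NormedSpace.exp_analytic (𝕂 := ℝ) x).contDiffAt

/-- `D exp : ℍ → (ℍ →L ℍ)` is continuous. -/
theorem continuous_fderiv_exp_quat : Continuous (fderiv ℝ (exp : ℍ → ℍ)) :=
  (contDiff_exp_quat (n := 1)).continuous_fderiv one_ne_zero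

omit [Fintype ι] in
/-- The guard in coordinates maps into the domain of `qlog`. -/
theorem mapsTo_guard (i : ι) :
    MapsTo (fun p : (ι → ℍ) × ℍ => p.1 i * star p.2) (guardSet ι) {z : ℍ | ‖z - 1‖ < 1} :=
  fun _ hp => hp i

omit [Fintype ι] in
/-- The coordinate map `(a, u) ↦ a_i ū` is continuous. -/
theorem continuous_coord (i : ι) : Continuous fun p : (ι → ℍ) × ℍ => p.1 i * star p.2 :=
  ((continuous_apply i).comp continuous_fst).mul (continuous_star.comp continuous_snd)

/-- The exponent `(a, u) ↦ Yf a c u` is continuous on the guard region. -/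
theorem continuousOn_Yf (c : ι → ℝ) : ContinuousOn (fun p : (ι → ℍ) × ℍ => Yf p.1 c p.2) (guardSet ι) := by
  unfold Yf
  refine continuousOn_finsetSum _ fun i _ => ?_
  have h1 : ContinuousOn (fun p : (ι → ℍ) × ℍ => qlog (p.1 i * star p.2)) (guardSet ι) :=
    continuousOn_qlog.comp (continuous_coord i).continuousOn (mapsTo_guard i)
  have h2 : (fun p : (ι → ℍ) × ℍ => c i • qlog (p.1 i * star p.2)) = fun p => (c i : ℍ) * qlog (p.1 i * star p.2) := by
    funext p; rw [Quaternion.coe_mul_eq_smul]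
  rw [h2]
  exact continuousOn_const.mul h1

/-- The differential of the exponent `(a, u) ↦ YD a c u` is continuous on the guard region (operator norm). -/
theorem continuousOn_YD (c : ι → ℝ) : ContinuousOn (fun p : (ι → ℍ) × ℍ => YD p.1 c p.2) (guardSet ι) := by
  have h : (fun p : (ι → ℍ) × ℍ => YD p.1 c p.2) = fun p =>
      ∑ i, c i • (fderiv ℝ qlog (p.1 i * star p.2)).comp ((ContinuousLinearMap.mul ℝ ℍ (p.1 i)).comp starCLM) :=
    funext fun p => YD_eq p.1 c p.2
  rw [h]
  refine continuousOn_finsetSum _ fun i _ => ?_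
  have h1 : ContinuousOn (fun p : (ι → ℍ) × ℍ => fderiv ℝ qlog (p.1 i * star p.2)) (guardSet ι) :=
    continuousOn_fderiv_qlog.comp (continuous_coord i).continuousOn (mapsTo_guard i)
  have h2 : Continuous (fun p : (ι → ℍ) × ℍ => (ContinuousLinearMap.mul ℝ ℍ (p.1 i)).comp starCLM) :=
    ((ContinuousLinearMap.mul ℝ ℍ).continuous.comp ((continuous_apply i).comp continuous_fst)).clm_comp
      continuous_const
  have h3 : ContinuousOn (fun p : (ι → ℍ) × ℍ =>
      (fderiv ℝ qlog (p.1 i * star p.2)).comp ((ContinuousLinearMap.mul ℝ ℍ (p.1 i)).comp starCLM)) (guardSet ι) :=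
    h1.clm_comp h2.continuousOn
  have h4 : (fun p : (ι → ℍ) × ℍ =>
      c i • (fderiv ℝ qlog (p.1 i * star p.2)).comp ((ContinuousLinearMap.mul ℝ ℍ (p.1 i)).comp starCLM)) =
      fun p => (c i • ContinuousLinearMap.id ℝ ℍ).comp
        ((fderiv ℝ qlog (p.1 i * star p.2)).comp ((ContinuousLinearMap.mul ℝ ℍ (p.1 i)).comp starCLM)) := by
    funext p; rw [ContinuousLinearMap.smul_comp, ContinuousLinearMap.id_comp]
  rw [h4]
  exact continuousOn_const.clm_comp h3

/-- **JOINT CONTINUITY OF THE DIFFERENTIAL OF THE FIBRE MAP** `(a, u) ↦ kD a c u` on the guard region. -/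
theorem continuousOn_kD (c : ι → ℝ) : ContinuousOn (fun p : (ι → ℍ) × ℍ => kD p.1 c p.2) (guardSet ι) := by
  have h : (fun p : (ι → ℍ) × ℍ => kD p.1 c p.2) = fun p => ContinuousLinearMap.mul ℝ ℍ (exp (Yf p.1 c p.2)) +
      ((ContinuousLinearMap.mul ℝ ℍ).flip p.2).comp ((fderiv ℝ exp (Yf p.1 c p.2)).comp (YD p.1 c p.2)) :=
    funext fun p => kD_eq p.1 c p.2
  rw [h]
  refine ContinuousOn.add ?_ ?_
  · exact (ContinuousLinearMap.mul ℝ ℍ).continuous.comp_continuousOn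
      ((contDiff_exp_quat (n := 0)).continuous.comp_continuousOn (continuousOn_Yf c))
  · refine ContinuousOn.clm_comp ?_ ?_
    · exact ((ContinuousLinearMap.mul ℝ ℍ).flip.continuous.comp continuous_snd).continuousOn
    · exact (continuous_fderiv_exp_quat.comp_continuousOn (continuousOn_Yf c)).clm_comp (continuousOn_YD c)

/-- **CONTINUITY AT THE DEGENERATE POINT**: `(a, u) ↦ kD a c u` is continuous at `(1, 1)`. -/
theorem continuousAt_kD_one (c : ι → ℝ) :
    ContinuousAt (fun p : (ι → ℍ) × ℍ => kD p.1 c p.2) ((fun _ : ι => (1 : ℍ)), (1 : ℍ)) :=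
  (continuousOn_kD c).continuousAt (isOpen_guardSet.mem_nhds one_mem_guardSet)

end Continuity

end Summit.QuantumFields.YangMills.Theorems.FibreLocalInverse

end
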